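import Literature.NumberTheory.EllipticCurves.IsogenyDualKernelMuCharacter
import Literature.NumberTheory.EllipticCurves.IsogenyDescentKummerElement
import HarnessLib

/-!
# The Kummer invariant of a locally trivial `ψ`-class is a descent value `f_T(P)/f_T(P₀)`
# (Silverman, *AEC*, Exercise 10.1(c) / Prop. X.4.9, cohomological form, over one field)

PROOF-ONLY file (theorems only, no definition, no named fact, no `sorry`), topic
`NumberTheory/EllipticCurves`; sequel of `IsogenyDualKernelMuCharacter` (the character
`χ : ker ψ ≅ μ_p` and the Kummer invariant `H¹(F, ker ψ) ↪ Fˣ/Fˣᵖ`) and of `IsogenyDescentKummerElement`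
(the Kummer element `h(R)/h(Q₀)` of the cocycle `σ ↦ e(σR − R, T)`).

Setting: `E/F` elliptic over a field of characteristic `0`, `p ≠ char F` prime, `T ∈ E(F̄)` a `Γ_F`-fixed
point of order `p`, `φ : E → E'` with `ker φ = ⟨T⟩`, `ψ : E' → E` with `ψ ∘ φ = [p]`, and `f ∈ F̄(E)` with
`div f = p(T) − p(O)` (a Kummer function `f_T`).

* **`dualKerChar_eq_weilPairingFun_of_coboundary`** — if a cocycle `c : Γ_F → ker ψ` is the coboundary of
  `Q' ∈ E'(F̄)` inside `E'` (`c(σ) = σQ' − Q'`: the class of `c` dies in `H¹(F, E')`, i.e. `c` lies in the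
  image of the Kummer map of `ψ`), then for any `R` with `φ(R) = Q'`: `χ(c(σ)) = e_p(σR − R, T)` — the
  `μ_p`-cocycle of `c` IS the Weil-pairing cocycle `χ_R` of Silverman III.§8 / Exercise 10.1(c).
* **`exists_mul_pow_eq_value_of_coboundary`** — THE KUMMER MAP IS THE DESCENT MAP: in that situation, with
  `P = ψ(Q') = pR ∉ {O, T}` (a `Γ_F`-fixed point), any Kummer generator `(α, a)` of `c` (`χ(c σ) = σα/α`,
  `αᵖ = a ∈ Fˣ`; it exists by Hilbert 90, `exists_root_of_cocycle`, and `[a] =` the Kummer invariant of `[c]`,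
  `kummerInvariant_oneCocycleClass_eq_of_root`) satisfies
  **`a · uᵖ · f(P₀) = f(P)` for some `u ∈ Fˣ`**, `P₀ = pQ₀` the multiple of a rational base point: the
  Kummer invariant of `[c]` is `f(P)/f(P₀) mod Fˣᵖ`. (Proof: `χ(cσ) = e(σR − R, T)`; the Kummer element
  `w = h(R)/h(Q₀)` has the same cocycle and `wᵖ f(P₀) = f(P)`; so `w/α ∈ F`.)
* `nsmul_fixed_of_coboundary`, `psi_eq_nsmul_of_apply_eq` — bookkeeping: `P = ψ Q' = pR` is `Γ_F`-fixed.

Applied at a completion `F = K_v` to the restriction of a Selmer class, this is the step «local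
condition ⟹ the Kummer invariant is a local descent value», whose valuation is then controlled by
`KubertTateKummer.exists_val_kummerFn_eq_pow` (the `μ₅`-side of the door at `5`, route ShaPrimaryTransfer).

## References

* [SilvermanAEC2009] J. H. Silverman, *The Arithmetic of Elliptic Curves*, 2nd ed., III.§8, Thm. X.1.1(c)
  and its proof, Thm. X.4.2(a), Prop. X.4.9, Exercise 10.1(c).
* [Fisher2001FiveSevenDescent] T. Fisher, JEMS 3 (2001), §1.

## Design

Theorems only; conventions of `IsogenyDualKernelMuCharacter` / `IsogenyDescentKummerElement`
(`F : Type u`, `[Fact p.Prime] [NeZero (p : F)]`, `galRingHom σ`, `HasValueAt`).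
-/

noncomputable section

open scoped Classical

universe u

namespace WeierstrassCurve.Isogeny

open Literature.NumberTheory.EllipticCurves Literature.NumberTheory.GaloisRepresentations
  Literature.NumberTheory.GaloisRepresentations.DiscreteGaloisModule Field
  Literature.NumberTheory.EllipticCurves.WeierstrassFunctionField

variable {F : Type u} [Field F] {W W' : WeierstrassCurve F} [W.IsElliptic] [W'.IsElliptic]
  (φ : Isogeny W W') (ψ : Isogeny W' W) {p : ℕ} [Fact p.Prime] [NeZero (p : F)]
  (h : ∀ P, ψ (φ P) = (p : ℤ) • P)
  (T : W.geomPoints) (hT : (p : ℤ) • T = 0) (hT0 : T ≠ 0)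
  (hTfix : ∀ σ : absoluteGaloisGroup F, σ • T = T)
  (hker : φ.toAddMonoidHom.ker = AddSubgroup.zmultiples T)

/-! ## Bookkeeping: `P = ψ(Q') = pR` is `Γ_F`-fixed -/

include h in
omit [W.IsElliptic] [W'.IsElliptic] [Fact p.Prime] [NeZero (p : F)] in
/-- If `φ R = Q'` then `ψ Q' = p • R`. [cite: SilvermanAEC2009, Thm. III.6.1(a)] -/
theorem psi_eq_zsmul_of_apply_eq {R : W.geomPoints} {Q' : W'.geomPoints} (hRQ : φ R = Q') :
    ψ Q' = (p : ℤ) • R := by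
  rw [← hRQ, h]

omit [W.IsElliptic] [W'.IsElliptic] [Fact p.Prime] [NeZero (p : F)] in
/-- If the cocycle `c : Γ_F → ker ψ` is the coboundary of `Q' ∈ E'(F̄)` inside `E'`, then `P = ψ(Q')` is
`Γ_F`-fixed (`σP − P = ψ(c σ) = O`). [cite: SilvermanAEC2009, Thm. X.4.2(a) (the Kummer sequence for φ)] -/
theorem smul_psi_eq_of_coboundary
    (c : letI := ψ.kerAction
      contOneCocycles (discreteTopRep (absoluteGaloisGroup F) ψ.toAddMonoidHom.ker))
    {Q' : W'.geomPoints} (hc : ∀ σ : absoluteGaloisGroup F, ((c.1 σ : ψ.toAddMonoidHom.ker) : W'.geomPoints) = σ • Q' - Q')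
    (σ : absoluteGaloisGroup F) : σ • ψ Q' = ψ Q' := by
  have hmem := (c.1 σ).2
  rw [AddMonoidHom.mem_ker, coe_toAddMonoidHom, hc σ, map_sub, Isogeny.map_smul, sub_eq_zero] at hmem
  exact hmem

/-! ## The `μ_p`-cocycle of a coboundary is the Weil-pairing cocycle `χ_R` -/

include h hT hker in
/-- **`χ(c(σ)) = e_p(σR − R, T)`** when `c(σ) = σQ' − Q'` in `E'(F̄)` and `φ(R) = Q'`: the `μ_p`-valued cocycle of
a class in the image of the Kummer map of `ψ` is Silverman's `χ_R(σ) = e(σR − R, T)` (`σR − R ∈ E[p]` is a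
`φ`-preimage of `c(σ)`). [cite: SilvermanAEC2009, Exercise 10.1(c) with III.§8] -/
theorem dualKerChar_eq_weilPairingFun_of_coboundary
    (c : letI := ψ.kerAction
      contOneCocycles (discreteTopRep (absoluteGaloisGroup F) ψ.toAddMonoidHom.ker))
    {Q' : W'.geomPoints} (hc : ∀ σ : absoluteGaloisGroup F, ((c.1 σ : ψ.toAddMonoidHom.ker) : W'.geomPoints) = σ • Q' - Q')
    {R : W.geomPoints} (hRQ : φ R = Q') (σ : absoluteGaloisGroup F) :
    ((muVal F p (dualKerChar φ ψ h T hT hker (c.1 σ)) : (AlgebraicClosure F)ˣ) : AlgebraicClosure F) =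
      weilPairingFun (natCast_level_ne_zero F p) (σ • R - R) T := by
  have hP : ψ Q' = (p : ℤ) • R := psi_eq_zsmul_of_apply_eq φ ψ h hRQ
  have hσR : (p : ℤ) • (σ • R - R) = 0 := by
    rw [smul_sub, smul_comm, ← hP, smul_psi_eq_of_coboundary ψ c hc σ, sub_self]
  exact coe_muVal_dualKerChar_eq φ ψ h T hT hker (c.1 σ) hσR
    (by rw [map_sub, Isogeny.map_smul, hRQ, hc σ])

/-! ## The Kummer invariant is the descent value -/

section Descent

variable [CharZero F] {f : W.geomFunctionField} (hf0 : f ≠ 0)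
  (hford : ∀ Q : W.geomPoints, ord (W.baseChange (AlgebraicClosure F)).toAffine Q f =
    (p : ℤ) * ((if Q = T then 1 else 0) - (if Q = 0 then 1 else 0)))

include h hT hTfix hker hf0 hford

/-- **The Kummer map is the descent map `P ↦ f_T(P)` (Silverman, Exercise 10.1(c)), cohomological form.**
Let `c : Γ_F → ker ψ` be a cocycle with `c(σ) = σQ' − Q'` for some `Q' ∈ E'(F̄)` (its class lies in the image of
the Kummer map of `ψ`), put `P = ψ(Q')` (a `Γ_F`-fixed point) and suppose `P ∉ {O, T}`, with `f(P) = b`. Let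
`Q₀ ∈ E(F̄)` be `Γ_F`-fixed with `P₀ = pQ₀ ∉ {O, T}`, `f(P₀) = a₀`. If `(α, a)` is a Kummer generator of `c`
(`χ(c σ) = σα/α` for all `σ`, `αᵖ = a ∈ Fˣ`), then **`a · uᵖ · a₀ = b` for some `u ∈ Fˣ`**: the Kummer
invariant `[a]` of `[c]` is `f(P)/f(P₀)` in `Fˣ/Fˣᵖ`. [cite: SilvermanAEC2009, Exercise 10.1(c) and the proof of Thm. X.1.1(c)]
[cite: Fisher2001FiveSevenDescent, §1] -/
theorem exists_mul_pow_eq_value_of_coboundary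
    (c : letI := ψ.kerAction
      contOneCocycles (discreteTopRep (absoluteGaloisGroup F) ψ.toAddMonoidHom.ker))
    {Q' : W'.geomPoints} (hc : ∀ σ : absoluteGaloisGroup F, ((c.1 σ : ψ.toAddMonoidHom.ker) : W'.geomPoints) = σ • Q' - Q')
    (hP0 : ψ Q' ≠ 0) (hPT : ψ Q' ≠ T) {b : AlgebraicClosure F} (hb : W.HasValueAt f (ψ Q') b)
    {Q₀ : W.geomPoints} (hQ₀0 : (p : ℤ) • Q₀ ≠ 0) (hQ₀T : (p : ℤ) • Q₀ ≠ T)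
    (hQ₀fix : ∀ σ : absoluteGaloisGroup F, σ • Q₀ = Q₀) {a₀ : AlgebraicClosure F}
    (ha₀ : W.HasValueAt f ((p : ℤ) • Q₀) a₀)
    {α : (AlgebraicClosure F)ˣ} {a : Fˣ}
    (hαp : α ^ p = Units.map (algebraMap F (AlgebraicClosure F) : F →* AlgebraicClosure F) a)
    (hcα : ∀ σ : absoluteGaloisGroup F, muVal F p (dualKerChar φ ψ h T hT hker (c.1 σ)) = σ • α / α) :
    ∃ u : F, u ≠ 0 ∧ algebraMap F (AlgebraicClosure F) ((a : F) * u ^ p) * a₀ = b := by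
  -- a `φ`-preimage `R` of `Q'`: `pR = ψ Q' = P`
  obtain ⟨R, hRQ⟩ := φ.surjective Q'
  have hP : ψ Q' = (p : ℤ) • R := psi_eq_zsmul_of_apply_eq φ ψ h hRQ
  have hR0 : (p : ℤ) • R ≠ 0 := hP ▸ hP0
  have hRT : (p : ℤ) • R ≠ T := hP ▸ hPT
  have hRfix : ∀ σ : absoluteGaloisGroup F, σ • ((p : ℤ) • R) = (p : ℤ) • R := fun σ ↦ by
    rw [← hP]; exact smul_psi_eq_of_coboundary ψ c hc σ
  -- the Kummer element of `χ_R`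
  obtain ⟨w, hw0, hw, hwp⟩ := exists_kummerElement hT hTfix hf0 hford hR0 hRT hRfix hQ₀0 hQ₀T hQ₀fix
    (hP ▸ hb) ha₀
  -- `w / α` is `Γ_F`-fixed
  have hα0 : (α : AlgebraicClosure F) ≠ 0 := α.ne_zero
  have hfix : ∀ σ : absoluteGaloisGroup F, galRingHom σ (w / α) = w / α := by
    intro σ
    have e1 : galRingHom σ w = weilPairingFun (natCast_level_ne_zero F p) (σ • R - R) T * w := hw σ
    have e2 : σ • (α : AlgebraicClosure F) =
        weilPairingFun (natCast_level_ne_zero F p) (σ • R - R) T * α := by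
      have e := congrArg (fun x : (AlgebraicClosure F)ˣ ↦ (x : AlgebraicClosure F)) (hcα σ)
      simp only [Units.val_div_eq_div_val, Units.coe_smul] at e
      rw [dualKerChar_eq_weilPairingFun_of_coboundary φ ψ h T hT hker c hc hRQ σ] at e
      rw [eq_div_iff hα0] at e
      exact e.symm
    have hε0 : weilPairingFun (natCast_level_ne_zero F p) (σ • R - R) T ≠ 0 := by
      intro h0
      rw [h0, zero_mul] at e2
      exact (smul_ne_zero_iff_ne σ |>.mpr hα0) e2
    rw [map_div₀, e1, galRingHom_apply, e2, mul_div_mul_left _ _ hε0]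
  obtain ⟨u, hu⟩ := exists_algebraMap_of_forall_galRingHom hfix
  refine ⟨u, ?_, ?_⟩
  · intro h0
    rw [h0, map_zero, eq_comm, div_eq_zero_iff] at hu
    exact hu.elim hw0 hα0
  · have hw' : w = α * algebraMap F (AlgebraicClosure F) u := by
      rw [hu, mul_div_cancel₀ _ hα0]
    have hαp' : (α : AlgebraicClosure F) ^ p = algebraMap F (AlgebraicClosure F) a := by
      have e := congrArg (fun x : (AlgebraicClosure F)ˣ ↦ (x : AlgebraicClosure F)) hαp
      simpa using e
    rw [← hwp, hw', mul_pow, hαp', map_mul, map_pow]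

end Descent

end WeierstrassCurve.Isogeny

end
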